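import Literature.MathematicalPhysics.QuantumLattice.HubbardNNNHoppingWeightedOpenBox
import Literature.MathematicalPhysics.QuantumLattice.HubbardOpenBoxCodedHamiltonian
import HarnessLib

/-!
# The WEIGHTED open-cluster `t–t'–U` Hubbard Hamiltonian as integer-coded functions of the occupation code
# (the dictionary for kernel exact-diagonalisation certificates of weighted Anderson clusters)

Topic `MathematicalPhysics/QuantumLattice`, family `hubbard` (seat hubbard-box-p3). The weighted twin of
`HubbardOpenBoxCodedHamiltonian.lean` (hubbard-box-p2: `H^open_{a×b}(t,t',U) s s' = -t·openBoxHopNN - t'·openBoxHopDiag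
+ U·doccCode` on the codes of `s, s'`). For the WEIGHTED cluster `hubbardOpenBoxTT'W a b τ υ ν`
(`HubbardNNNHoppingWeightedOpenBox.lean`: bond weights `τ`, site repulsions `υ`, on-site potentials `ν` — the
cluster of the weighted Anderson cover of Valentí–Stolze–Hirschfeld 1991 §II, whose bound
`ClusterLowerBound.energyDensityTT'_ge_of_boxFloorsW_2x3` consumes kernel sector floors of exactly this
operator) with INTEGER weight tables on the row-major site ranks,
`τ x y = W (siteRank x) (siteRank y)`, `υ x = V (siteRank x)`, `ν x = M (siteRank x)`, the entries are

  `h^W s s' = hzIntW a b W V M (code s) (code s')`,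
  `hzIntW = -openBoxHopW W (boxAdjCode b) (ab) + doccCodeW V (ab) + densCodeW M (ab)`

(`hubbardOpenBoxTT'W_apply_eq_hzIntW`), all loops structural (`sumNat`) so that the kernel evaluates them by
`decide`; rational weights `W/q, V/q, M/q` give `h^W s s' = hzIntW/q` (`hubbardOpenBoxTT'W_apply_eq_hzIntW_div`,
from the homogeneity `hubbardOpenBoxTT'W_scale`); for symmetric `W` the coded matrix is symmetric
(`hzIntW_code_symm`). This is the input of box-p2's in-kernel Cholesky device (`HubbardOpenBoxSectorRows`,
`HubbardOpenBoxEDCertificateKronecker`) for weighted clusters; nothing numerical is asserted here.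

References: H. Q. Lin, J. E. Gubernatis, Comput. Phys. 7 (1993) 400, §II (integer-coded occupations, fermion
signs by bit counting) [cite: LinGubernatis1993, §II]; R. Valentí, J. Stolze, P. J. Hirschfeld, Phys. Rev. B 43
(1991) 13743, §II [cite: ValentiStolzeHirschfeld1991, §II]. Everything is proved; the five definitions have bodies;
no named facts, no instances.
-/

noncomputable section

namespace Literature.MathematicalPhysics.QuantumLattice

namespace OccupationCode

open Finset Matrix ClusterLowerBound

/-! ### §1 The coded entry functions of the weighted cluster -/

/-- Coded nearest-neighbour-OR-diagonal adjacency of the open `a × b` box (row-major ranks): the support of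
the bond weights of the weighted cluster. [cite: LinGubernatis1993, §II] -/
def boxAdjCode (b P Q : ℕ) : Bool := nnAdjCode b P Q || diagAdjCode b P Q

/-- **Weighted coded hopping matrix** `Σ_{P, Q < N, adj P Q} W P Q · Σ_σ (c†_{Pσ} c_{Qσ})` (entry between the codes
`m`, `n`; integer bond weights `W`). [cite: LinGubernatis1993, §II] -/
def openBoxHopW (W : ℕ → ℕ → ℤ) (adj : ℕ → ℕ → Bool) (N m n : ℕ) : ℤ :=
  sumNat (fun P => sumNat (fun Q => if adj P Q then
    W P Q * sumNat (fun σ => hopCode (2 * P + σ) (2 * Q + σ) m n) 2 else 0) N) N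

/-- **Weighted coded double occupancy** `[m = n] · Σ_P V P · [bits 2P, 2P+1 of m set]` (integer site repulsions
`V`). [cite: LinGubernatis1993, §II] -/
def doccCodeW (V : ℕ → ℤ) (N m n : ℕ) : ℤ :=
  if m = n then sumNat (fun P => if m.testBit (2 * P) && m.testBit (2 * P + 1) then V P else 0) N else 0

/-- **Weighted coded density** `[m = n] · Σ_P M P · ([bit 2P of m set] + [bit 2P+1 of m set])` (integer on-site
potentials `M`). [cite: LinGubernatis1993, §II] -/
def densCodeW (M : ℕ → ℤ) (N m n : ℕ) : ℤ :=
  if m = n then sumNat (fun P => (if m.testBit (2 * P) then M P else 0) + (if m.testBit (2 * P + 1) then M P else 0)) N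
  else 0

/-- **The integer-coded entry function of the weighted cluster**:
`hzIntW = -openBoxHopW W (boxAdjCode b) (ab) + doccCodeW V (ab) + densCodeW M (ab)`. [cite: LinGubernatis1993, §II] -/
def hzIntW (a b : ℕ) (W : ℕ → ℕ → ℤ) (V M : ℕ → ℤ) (m m' : ℕ) : ℤ :=
  -openBoxHopW W (boxAdjCode b) (a * b) m m' + doccCodeW V (a * b) m m' + densCodeW M (a * b) m m'

/-- Casting a structural integer sum. [folklore] -/
private theorem cast_sumNat' (f : ℕ → ℤ) : ∀ n : ℕ, ((sumNat f n : ℤ) : ℂ) = sumNat (fun i => (f i : ℂ)) n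
  | 0 => by simp [sumNat]
  | n + 1 => by rw [sumNat, sumNat, Int.cast_add, cast_sumNat' f n]

/-! ### §2 The dictionary -/

section Dictionary

variable {a b : ℕ}

/-- The coded box adjacency is the nearest-neighbour-or-diagonal adjacency of the open box.
[cite: LeBlancEtAl2015, eq. (1)] -/
theorem boxAdjCode_siteRank (x y : Fin a ×ₗ Fin b) :
    boxAdjCode b (siteRank x) (siteRank y) = true ↔ (rectBoxGraph a b).Adj x y ∨ (rectBoxDiagGraph a b).Adj x y := by
  rw [boxAdjCode, Bool.or_eq_true, nnAdjCode_siteRank, diagAdjCode_siteRank]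

/-- **Entries of the weighted cluster Hamiltonian** in the occupation basis:
`h^W s s' = -Σ_{x,y,σ} [x ~ y ∨ x ~~ y] τ(x,y) (c†_{xσ} c_{yσ}) s s' + Σ_x υ(x) (n_{x↑}n_{x↓}) s s' + Σ_x ν(x) ((n_{x↑}) s s' + (n_{x↓}) s s')`.
[cite: EsslerEtAl2005, §2.1] -/
theorem hubbardOpenBoxTT'W_apply (τ : Fin a ×ₗ Fin b → Fin a ×ₗ Fin b → ℝ) (υ ν : Fin a ×ₗ Fin b → ℝ)
    (s s' : Finset (Orb (Fin a ×ₗ Fin b))) :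
    hubbardOpenBoxTT'W a b τ υ ν s s' =
      -(∑ x : Fin a ×ₗ Fin b, ∑ y : Fin a ×ₗ Fin b, ∑ σ : Fin 2,
          if (rectBoxGraph a b).Adj x y ∨ (rectBoxDiagGraph a b).Adj x y then
            ((τ x y : ℝ) : ℂ) * (creation (orb x σ) * annihilation (orb y σ)) s s' else 0) +
        ∑ x : Fin a ×ₗ Fin b, ((υ x : ℝ) : ℂ) * (numberOp x 0 * numberOp x 1) s s' +
        ∑ x : Fin a ×ₗ Fin b, ((ν x : ℝ) : ℂ) * ((numberOp x 0) s s' + (numberOp x 1) s s') := by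
  rw [hubbardOpenBoxTT'W, Matrix.add_apply, Matrix.add_apply, Matrix.neg_apply]
  congr 1
  congr 1
  · congr 1
    rw [Matrix.sum_apply]
    refine Finset.sum_congr rfl fun x _ => ?_
    rw [Matrix.sum_apply]
    refine Finset.sum_congr rfl fun y _ => ?_
    rw [Matrix.sum_apply]
    refine Finset.sum_congr rfl fun σ _ => ?_
    split_ifs
    · rw [Matrix.smul_apply, smul_eq_mul]
    · rfl
  · rw [Matrix.sum_apply]
    refine Finset.sum_congr rfl fun x _ => ?_
    rw [Matrix.smul_apply, smul_eq_mul]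
  · rw [Matrix.sum_apply]
    refine Finset.sum_congr rfl fun x _ => ?_
    rw [Matrix.smul_apply, smul_eq_mul, Matrix.add_apply]

/-- The weighted hopping part in code form. [cite: LinGubernatis1993, §II] -/
theorem sum_hopW_eq_openBoxHopW (W : ℕ → ℕ → ℤ) (s s' : Finset (Orb (Fin a ×ₗ Fin b))) :
    (∑ x : Fin a ×ₗ Fin b, ∑ y : Fin a ×ₗ Fin b, ∑ σ : Fin 2,
        if (rectBoxGraph a b).Adj x y ∨ (rectBoxDiagGraph a b).Adj x y then
          (((W (siteRank x) (siteRank y) : ℤ) : ℝ) : ℂ) * (creation (orb x σ) * annihilation (orb y σ)) s s' else 0) =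
      ((openBoxHopW W (boxAdjCode b) (a * b) (code s) (code s') : ℤ) : ℂ) := by
  simp only [openBoxHopW, cast_sumNat', Int.cast_ite, Int.cast_zero, Int.cast_mul]
  rw [← sum_site_eq_sumNat]
  refine Finset.sum_congr rfl fun x _ => ?_
  rw [← sum_site_eq_sumNat]
  refine Finset.sum_congr rfl fun y _ => ?_
  by_cases hxy : (rectBoxGraph a b).Adj x y ∨ (rectBoxDiagGraph a b).Adj x y
  · rw [if_pos ((boxAdjCode_siteRank x y).2 hxy)]
    simp only [if_pos hxy]
    rw [Fin.sum_univ_two, sumNat, sumNat, sumNat, creation_mul_annihilation_apply_eq_hopCode,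
      creation_mul_annihilation_apply_eq_hopCode, orbRank_orb, orbRank_orb, orbRank_orb, orbRank_orb]
    push_cast
    simp only [Fin.val_zero, Fin.val_one, add_zero, zero_add]
    ring
  · have : boxAdjCode b (siteRank x) (siteRank y) = false := Bool.eq_false_iff.2 fun h => hxy ((boxAdjCode_siteRank x y).1 h)
    rw [this]
    simp [hxy]

/-- The weighted double occupancy in code form. [cite: LinGubernatis1993, §II] -/
theorem sum_doccW_eq_doccCodeW (V : ℕ → ℤ) (s s' : Finset (Orb (Fin a ×ₗ Fin b))) :
    (∑ x : Fin a ×ₗ Fin b, (((V (siteRank x) : ℤ) : ℝ) : ℂ) * (numberOp x 0 * numberOp x 1) s s') =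
      ((doccCodeW V (a * b) (code s) (code s') : ℤ) : ℂ) := by
  rw [doccCodeW]
  by_cases hss : s = s'
  · subst hss
    rw [if_pos rfl, cast_sumNat', ← sum_site_eq_sumNat]
    refine Finset.sum_congr rfl fun x _ => ?_
    have h0 := mem_iff_testBit_code s (orb x 0)
    have h1 := mem_iff_testBit_code s (orb x 1)
    rw [orbRank_orb] at h0 h1
    rw [numberOp_mul_numberOp_apply, if_pos rfl]
    simp only [Fin.val_zero, add_zero, Fin.val_one] at h0 h1
    by_cases hx0 : orb x 0 ∈ s
    · by_cases hx1 : orb x 1 ∈ s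
      · rw [if_pos hx0, if_pos hx1, h0.1 hx0, h1.1 hx1]; simp
      · have : (code s).testBit (2 * siteRank x + 1) = false := Bool.eq_false_iff.2 fun h => hx1 (h1.2 h)
        rw [if_pos hx0, if_neg hx1, this]; simp
    · have : (code s).testBit (2 * siteRank x) = false := Bool.eq_false_iff.2 fun h => hx0 (h0.2 h)
      rw [if_neg hx0, this]; simp
  · have : code s ≠ code s' := fun h => hss (code_injective h)
    rw [if_neg this]
    simp only [numberOp_mul_numberOp_apply, if_neg hss, mul_zero, Finset.sum_const_zero, Int.cast_zero]

/-- The weighted density in code form. [cite: LinGubernatis1993, §II] -/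
theorem sum_densW_eq_densCodeW (M : ℕ → ℤ) (s s' : Finset (Orb (Fin a ×ₗ Fin b))) :
    (∑ x : Fin a ×ₗ Fin b, (((M (siteRank x) : ℤ) : ℝ) : ℂ) * ((numberOp x 0) s s' + (numberOp x 1) s s')) =
      ((densCodeW M (a * b) (code s) (code s') : ℤ) : ℂ) := by
  rw [densCodeW]
  simp only [LiebThm1.numberOp_eq_diagonal, diagonal_apply]
  by_cases hss : s = s'
  · subst hss
    rw [if_pos rfl, cast_sumNat', ← sum_site_eq_sumNat]
    refine Finset.sum_congr rfl fun x _ => ?_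
    have h0 := mem_iff_testBit_code s (orb x 0)
    have h1 := mem_iff_testBit_code s (orb x 1)
    rw [orbRank_orb] at h0 h1
    simp only [Fin.val_zero, add_zero, Fin.val_one] at h0 h1
    rw [if_pos rfl, if_pos rfl]
    by_cases hx0 : orb x 0 ∈ s
    · by_cases hx1 : orb x 1 ∈ s
      · rw [if_pos hx0, if_pos hx1, h0.1 hx0, h1.1 hx1]; push_cast; simp; ring
      · have : (code s).testBit (2 * siteRank x + 1) = false := Bool.eq_false_iff.2 fun h => hx1 (h1.2 h)
        rw [if_pos hx0, if_neg hx1, h0.1 hx0, this]; push_cast; simp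
    · have h0' : (code s).testBit (2 * siteRank x) = false := Bool.eq_false_iff.2 fun h => hx0 (h0.2 h)
      by_cases hx1 : orb x 1 ∈ s
      · rw [if_neg hx0, if_pos hx1, h0', h1.1 hx1]; push_cast; simp
      · have : (code s).testBit (2 * siteRank x + 1) = false := Bool.eq_false_iff.2 fun h => hx1 (h1.2 h)
        rw [if_neg hx0, if_neg hx1, h0', this]; push_cast; simp
  · have : code s ≠ code s' := fun h => hss (code_injective h)
    rw [if_neg this]
    simp [if_neg hss]

/-- **THE DICTIONARY (integer weights).** With bond weights `τ x y = W (siteRank x) (siteRank y)`, repulsions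
`υ x = V (siteRank x)` and potentials `ν x = M (siteRank x)` read from integer tables on the row-major ranks,
`h^W s s' = hzIntW a b W V M (code s) (code s')`. [cite: LinGubernatis1993, §II] -/
theorem hubbardOpenBoxTT'W_apply_eq_hzIntW (W : ℕ → ℕ → ℤ) (V M : ℕ → ℤ) (s s' : Finset (Orb (Fin a ×ₗ Fin b))) :
    hubbardOpenBoxTT'W a b (fun x y => (W (siteRank x) (siteRank y) : ℝ)) (fun x => (V (siteRank x) : ℝ))
        (fun x => (M (siteRank x) : ℝ)) s s' =
      ((hzIntW a b W V M (code s) (code s') : ℝ) : ℂ) := by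
  rw [hubbardOpenBoxTT'W_apply, sum_hopW_eq_openBoxHopW, sum_doccW_eq_doccCodeW, sum_densW_eq_densCodeW, hzIntW]
  push_cast
  ring

/-- **Homogeneity of the weighted cluster** in its weight tables: `h^W(cτ, cυ, cν) = c · h^W(τ, υ, ν)`.
[cite: ValentiStolzeHirschfeld1991, §II] -/
theorem hubbardOpenBoxTT'W_scale (c : ℝ) (τ : Fin a ×ₗ Fin b → Fin a ×ₗ Fin b → ℝ) (υ ν : Fin a ×ₗ Fin b → ℝ) :
    hubbardOpenBoxTT'W a b (fun x y => c * τ x y) (fun x => c * υ x) (fun x => c * ν x) =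
      (c : ℂ) • hubbardOpenBoxTT'W a b τ υ ν := by
  unfold hubbardOpenBoxTT'W
  rw [smul_add, smul_add, smul_neg, Finset.smul_sum, Finset.smul_sum, Finset.smul_sum]
  congr 1
  congr 1
  · congr 1
    refine Finset.sum_congr rfl fun x _ => ?_
    rw [Finset.smul_sum]
    refine Finset.sum_congr rfl fun y _ => ?_
    rw [Finset.smul_sum]
    refine Finset.sum_congr rfl fun σ _ => ?_
    split_ifs
    · rw [smul_smul, Complex.ofReal_mul]
    · rw [smul_zero]
  · refine Finset.sum_congr rfl fun x _ => ?_
    rw [smul_smul, Complex.ofReal_mul]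
  · refine Finset.sum_congr rfl fun x _ => ?_
    rw [smul_smul, Complex.ofReal_mul]

/-- **THE DICTIONARY (rational weights `W/q`, `V/q`, `M/q`)**: `h^W s s' = hzIntW (code s) (code s') / q`.
[cite: LinGubernatis1993, §II] -/
theorem hubbardOpenBoxTT'W_apply_eq_hzIntW_div (W : ℕ → ℕ → ℤ) (V M : ℕ → ℤ) (q : ℝ)
    (s s' : Finset (Orb (Fin a ×ₗ Fin b))) :
    hubbardOpenBoxTT'W a b (fun x y => (W (siteRank x) (siteRank y) : ℝ) / q) (fun x => (V (siteRank x) : ℝ) / q)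
        (fun x => (M (siteRank x) : ℝ) / q) s s' =
      (((hzIntW a b W V M (code s) (code s') : ℝ) / q : ℝ) : ℂ) := by
  have h := hubbardOpenBoxTT'W_scale (a := a) (b := b) q⁻¹ (fun x y => (W (siteRank x) (siteRank y) : ℝ))
    (fun x => (V (siteRank x) : ℝ)) (fun x => (M (siteRank x) : ℝ))
  simp only [← div_eq_inv_mul] at h
  rw [h, Matrix.smul_apply, hubbardOpenBoxTT'W_apply_eq_hzIntW, smul_eq_mul, div_eq_inv_mul, Complex.ofReal_mul,
    Complex.ofReal_inv]

/-- **Symmetry of the coded matrix** for symmetric bond weights (`h^W` is Hermitian with real entries).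
[cite: LinGubernatis1993, §II] -/
theorem hzIntW_code_symm (W : ℕ → ℕ → ℤ) (hW : ∀ P Q, W P Q = W Q P) (V M : ℕ → ℤ)
    (s s' : Finset (Orb (Fin a ×ₗ Fin b))) :
    hzIntW a b W V M (code s) (code s') = hzIntW a b W V M (code s') (code s) := by
  have hH := (hubbardOpenBoxTT'W_isHermitian (r := a) (c := b) (fun x y => (W (siteRank x) (siteRank y) : ℝ))
    (fun x y => by simp only [hW]) (fun x => (V (siteRank x) : ℝ)) (fun x => (M (siteRank x) : ℝ))).apply s s'
  rw [hubbardOpenBoxTT'W_apply_eq_hzIntW, hubbardOpenBoxTT'W_apply_eq_hzIntW, RCLike.star_def,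
    Complex.conj_ofReal] at hH
  exact_mod_cast hH.symm

end Dictionary

end OccupationCode

end Literature.MathematicalPhysics.QuantumLattice
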